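import Literature.MathematicalPhysics.QuantumFieldTheory.Balaban1983to89.B8SockHFPDentedCubeMember
import Literature.MathematicalPhysics.QuantumFieldTheory.Balaban1983to89.B8DentedCubeMemberZdRec
import Literature.MathematicalPhysics.QuantumFieldTheory.Balaban1983to89.B8Eq131CubesRecDictionary

/-!
# `Balaban1983to89.B8SockHFPDentedCubeMemberRec` — RECORD TWIN of `B8SockHFPDentedCubeMember` ([Balaban1985RegularSpaces] (1.68) p. 88 ∕ (1.5)–(1.6) p. 77 ON THE DENTED TOWER OF
# [Balaban1985Variational] (148)–(150): the three MEMBER LAWS `htw ∕ h8lt ∕ h8top` of the Prop.-5 servers for the DENTED TRUNCATED CELLS) FOR THE SYMMETRISED CENTRED block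
# averaging (0.4) of [Balaban1987RG1] — at the record datum `c : Node00.CubeB8DZ d L K Ω` (centred tower, `flmZ ∕ UnderZ` blocks)

statement-level skeleton of published theorems with citation tags; proofs where landed; nothing here is a claim about the Yang–Mills mass gap

T. Bałaban, *Spaces of regular gauge field configurations on a lattice and gauge fixing conditions*, Commun. Math. Phys. **99** (1985) 75–102 `[Balaban1985RegularSpaces]`
("[6]"): (1.68) p. 88 («taking Λ_{k−1} ∪ B(Λ_k) as Λ_{k−1}»), (1.5)–(1.6) p. 77, p. 98, (1.131) p. 99; T. Bałaban, *The variational problem and background fields in renormalization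
group method for lattice gauge theories*, Commun. Math. Phys. **102** (1985) 277–309 `[Balaban1985Variational]` ("[15]"): (148)–(150) p. 301; T. Bałaban, *Renormalization group
approach to lattice gauge field theories. I*, Commun. Math. Phys. **109** (1987) 249–301 `[Balaban1987RG1]` ("[I]"): (0.3)–(0.4) pp. 252–253.  STATUS: published.

CITATION HEADER (lean-in-tree rule).  Cell `pub-ymgap`, «N05-REC» stage 2 (director-ym №254∕№255∕№288), item R6 crown tail, «side file independent of Sect. E» — typed by
`pub-ymgap-dag-n07-w3` g11 on the LEAD PEN dag-n05-e g39's word «TAKE» (cell bus 2026-08-29 14:45Z); engine module by dag-n05-e g31 (on dag-n05-c's dented twins GO).  WHAT IS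
REPRODUCED = ✓ the engine's three theorems `htw_lamST` · `h8lt_lamST` · `h8top_lamST` VERBATIM under the token map, for the consumer (g)-4 `B8Prop6DentedCubeMemberFlatScalarGammaRec`
(engine `B8Prop6DentedCubeMemberFlatScalarGamma` :282–:284).  TOKEN MAP (T2, centred tower; odd `L`): `CubeB8D ↦ Node00.CubeB8DZ`, `CubeB8D.lamST ↦ CubeB8DZ.lamST`
(`B8DentedCubeMemberZdRec`), the tower box `InBox (B8Ineq130.tlo L y j) (B8Ineq130.thi L y j) x` ↦ the CENTRED tower box `InBox (B8Ineq130Rec.tlo L y j) (B8Ineq130Rec.thi L y j) x`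
(⟺ `UnderZ L j y x` of `B8Eq119TwistedAxialRec`, variants `…_underZ`), the corner `L`-block `x ∈ blockSites L y` ↦ dag-n05-c's centred `L`-block `x ∈ B7SectEFLinearisationRec.blockSitesZ L y`
(⟺ `UnderZ L 1 y x`) — the binder shapes of the record sockets (`B8Prop5SocketDatumRec.restr129Z_succ_of_truncation`, dag-n05-e's `B8SockHFPRD` record twins; shapes fixed by dag-n05-e,
cell bus 2026-08-29 14:58Z).  PROOFS = the engine theorems at the (T2) translation `c.translate`
(`Node00/CarriersB8CubeDentedRecTranslate`, dag-n05-e (e)′-2a) carried back by the dictionaries `B8DentedCubeMemberZdRec.mem_lamST_iff_add_ctrShift` ∕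
`add_ctrShift_mem_translate_sq_iff` (dag-n05-e g38) and `B8Eq131CubesRecDictionary.underZ_iff_under_add_ctrShift` (n07-w3 g10).  Declaration names = engine names (T5).
Kind «kernel-checked proof», theorems only; no `def`, no `instance`, no `notation`, no existing module modified.  `--supports stmt-QuantumFields-20541` (K0⁷-keyed, COUNT-NEUTRAL).

HONEST SCOPE: set algebra on the dented record tower carried through a translation; no estimate; nothing of [6]∕[15]∕[I] asserted; `HThm4Rec` UNDISCHARGED; caveat (C-S3-1) + addendum
v4 stand; N05 [B8] DISCHARGED OF RECORD untouched; N05 ∕ N07 NOT discharged; COUNT of record unmoved · K numerically unchanged; one finite `𝕋⁴` programme at fixed `ε`, Bałaban AS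
PRINTED; nothing continuum ∕ ℝ⁴ ∕ OS ∕ mass-gap ∕ Clay.  No `sorry`, no `def`.

[cite: Balaban1985RegularSpaces, (1.68) p.88, (1.5)–(1.6) p.77, p.98, (1.131) p.99; Balaban1985Variational, (148)–(150) p.301; Balaban1987RG1, (0.3)–(0.4) pp.252–253]
-/

noncomputable section

namespace Literature.MathematicalPhysics.QuantumFieldTheory.Balaban1983to89.B8SockHFPDentedCubeMemberRec

open B7Prop1Explicit B7Prop1Local
open B8Ineq132 (Under)
open BlockAveragingZd (ctrShift)
open B8Eq119TwistedAxialRec (UnderZ mem_blockSitesZ_pow_iff)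
open B8Ineq130Rec (tlo thi tlo_apply thi_apply)
open B7SectEFLinearisationRec (blockSitesZ)
open B8Eq131CubesRecDictionary (underZ_iff_under_add_ctrShift)
open B8CubeMemberZd (inBox_tower_iff_under)
open B8Eq191FlatLettersCubeMember (under_iff_blockMap_eq)
open B8DentedCubeMemberZdRec (mem_lamST_iff_add_ctrShift add_ctrShift_mem_translate_sq_iff)
open QuantumLattice (blockSites)
open Literature.MathematicalPhysics.QuantumLattice (blockMap mem_blockSites_iff)
open Node00 (CubeB8D CubeB8DZ)

-- `Site` alone would resolve to the torus sites of `Setup.lean`; re-export the `ℤ^d` sites of `B7Prop1Explicit`.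
export B7Prop1Explicit (Site)

variable {d : ℕ} {L K : ℕ} {Ω : ℕ → Set (Site d)} (c : CubeB8DZ d L K Ω)

/-- **The centred tower box is `UnderZ`**: `InBox (tlo L y j) (thi L y j) x ↔ UnderZ L j y x` (`B8Ineq130Rec`'s CENTRED tower with `lo = hi = y`; odd `L`) — the bridge
between the record sockets' tower binder and `B8Eq119TwistedAxialRec.UnderZ` (cf. `B8Eq106LocalRec.under_iff_tower`, the `≤`-form). [cite: Balaban1985RegularSpaces, p.79 («x₀ ∈ Bʲ(x_j)»), p.98; Balaban1987RG1, (0.3) p.252] -/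
theorem inBox_tower_iff_underZ (hL : Odd L) (j : ℕ) (y x : Site d) : InBox (tlo L y j) (thi L y j) x ↔ UnderZ L j y x := by
  refine forall_congr' fun i => ?_
  rw [tlo_apply hL, thi_apply hL]
  constructor
  · rintro ⟨h1, h2⟩; exact ⟨by linarith, by linarith⟩
  · rintro ⟨h1, h2⟩; exact ⟨by linarith, by linarith⟩

/-- **The centred `L`-block Finset is `UnderZ L 1`**: `x ∈ blockSitesZ L y ↔ UnderZ L 1 y x` (dag-n05-c's `B7SectEFLinearisationRec.blockSitesZ`; odd `L`) —
`B8Eq119TwistedAxialRec.mem_blockSitesZ_pow_iff` at `j = 1`. [cite: Balaban1987RG1, (0.3) p.252; Balaban1985RegularSpaces, (1.6) p.77] -/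
theorem mem_blockSitesZ_iff_underZ_one (hL : Odd L) (y x : Site d) : x ∈ blockSitesZ L y ↔ UnderZ L 1 y x := by
  rw [← mem_blockSitesZ_pow_iff hL 1 y x, pow_one]

/-- (RECORD TWIN of `B8SockHFPDentedCubeMember.htw_lamST`, `UnderZ` form.) **Towers of EVERY truncation of the dented record member lie in the dented tower**: for `j ≤ m ≤ k`,
`y ∈ c.lamST m j` and `x` in the CENTRED level-`j` block of `y` (`UnderZ L j y x`), `x ∈ Ω′_j = c.sq j` (odd `L`). [cite: Balaban1985RegularSpaces, p.98, (1.5)–(1.6) p.77; Balaban1985Variational, (148)–(150) p.301; Balaban1987RG1, (0.3) p.252] -/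
theorem htw_lamST_underZ (hL : Odd L) :
    ∀ m, m ≤ c.k → ∀ j, j ≤ m → ∀ y ∈ c.lamST m j, ∀ x, UnderZ L j y x → x ∈ c.sq j := by
  intro m hm j hj y hy x hx
  have hL1 : 1 ≤ L := hL.pos
  have hjk : j ≤ c.k := hj.trans hm
  rw [underZ_iff_under_add_ctrShift hL hjk, ← inBox_tower_iff_under] at hx
  have h := B8SockHFPDentedCubeMember.htw_lamST (c.translate hL) hL1 m (by simpa using hm) j hj _ ((mem_lamST_iff_add_ctrShift c hL m j y).1 hy) _ hx
  exact (add_ctrShift_mem_translate_sq_iff c hL j x).1 h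

/-- (RECORD TWIN of `B8SockHFPDentedCubeMember.htw_lamST`.) ★ **Towers of EVERY truncation of the dented record member lie in the dented tower** (`htw`), in the record
sockets' binder shape: for `j ≤ m ≤ k`, `y ∈ c.lamST m j` and `x` in the CENTRED tower box `InBox (tlo L y j) (thi L y j) x` of `B8Ineq130Rec`, `x ∈ Ω′_j = c.sq j` (odd `L`) —
VERBATIM the `htower` binder of the record Prop.-5 servers. [cite: Balaban1985RegularSpaces, p.98, (1.5)–(1.6) p.77; Balaban1985Variational, (148)–(150) p.301; Balaban1987RG1, (0.3) p.252] -/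
theorem htw_lamST (hL : Odd L) :
    ∀ m, m ≤ c.k → ∀ j, j ≤ m → ∀ y ∈ c.lamST m j, ∀ x, InBox (tlo L y j) (thi L y j) x → x ∈ c.sq j :=
  fun m hm j hj y hy x hx => htw_lamST_underZ c hL m hm j hj y hy x ((inBox_tower_iff_underZ hL j y x).1 hx)

/-- (RECORD TWIN of `B8SockHFPDentedCubeMember.h8lt_lamST`.) **The truncation law below the truncation level** (`h8lt`): for `j < m < k` the truncated dented record cells at `m`
and `m + 1` agree (odd `L`). [cite: Balaban1985RegularSpaces, (1.68) p.88; Balaban1985Variational, (150) p.301; Balaban1987RG1, (0.3) p.252] -/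
theorem h8lt_lamST (hL : Odd L) : ∀ m, m < c.k → ∀ j, j < m → c.lamST m j = c.lamST (m + 1) j := by
  intro m hm j hj
  have h := B8SockHFPDentedCubeMember.h8lt_lamST (c.translate hL) m (by simpa using hm) j hj
  ext z
  rw [mem_lamST_iff_add_ctrShift c hL m j z, mem_lamST_iff_add_ctrShift c hL (m + 1) j z, h]

/-- (RECORD TWIN of `B8SockHFPDentedCubeMember.h8top_lamST`, `UnderZ` form.) **The truncation law AT the truncation level** ((1.68) «taking Λ_{k−1} ∪ B(Λ_k) as Λ_{k−1}» between
the truncations `m` and `m + 1`), centred blocks: for `m < k`, a level-`m` label `x` is a cell of the truncation at `m` iff it is one at `m + 1` or lies in the CENTRED `L`-block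
(`UnderZ L 1 y x`) of a level-`(m+1)` cell `y` of the truncation at `m + 1` (odd `L`). [cite: Balaban1985RegularSpaces, (1.68) p.88, (1.6) p.77, (1.131) p.99; Balaban1985Variational, (148)–(150) p.301; Balaban1987RG1, (0.3) p.252] -/
theorem h8top_lamST_underZ (hL : Odd L) :
    ∀ m, m < c.k → ∀ x, x ∈ c.lamST m m ↔
      x ∈ c.lamST (m + 1) m ∨ ∃ y ∈ c.lamST (m + 1) (m + 1), UnderZ L 1 y x := by
  intro m hmk x
  have hL1 : 1 ≤ L := hL.pos
  haveI : NeZero L := ⟨by omega⟩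
  have hkm : 1 ≤ c.k - m := by omega
  have h := B8SockHFPDentedCubeMember.h8top_lamST (c.translate hL) hL1 m (by simpa using hmk) (x + fun _ => (ctrShift L (c.k - m) : ℤ))
  rw [mem_lamST_iff_add_ctrShift c hL m m x, mem_lamST_iff_add_ctrShift c hL (m + 1) m x, h]
  -- the block disjunct: `x + c_{k−m} ∈ blockSites L y′` for an engine cell `y′ = y + c_{k−(m+1)}` iff `UnderZ L 1 y x` for the record cell `y`
  refine or_congr Iff.rfl ⟨?_, ?_⟩
  · rintro ⟨y', hy', hxy'⟩
    refine ⟨y' - fun _ => (ctrShift L (c.k - (m + 1)) : ℤ), ?_, ?_⟩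
    · rw [mem_lamST_iff_add_ctrShift c hL (m + 1) (m + 1), sub_add_cancel]; exact hy'
    · rw [underZ_iff_under_add_ctrShift hL hkm, show c.k - m - 1 = c.k - (m + 1) by omega, sub_add_cancel,
        under_iff_blockMap_eq hL1, pow_one]
      exact (mem_blockSites_iff L y' _).1 hxy'
  · rintro ⟨y, hy, hxy⟩
    refine ⟨y + fun _ => (ctrShift L (c.k - (m + 1)) : ℤ), (mem_lamST_iff_add_ctrShift c hL (m + 1) (m + 1) y).1 hy, ?_⟩
    rw [underZ_iff_under_add_ctrShift hL hkm, show c.k - m - 1 = c.k - (m + 1) by omega, under_iff_blockMap_eq hL1, pow_one] at hxy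
    exact (mem_blockSites_iff L _ _).2 hxy

/-- (RECORD TWIN of `B8SockHFPDentedCubeMember.h8top_lamST`.) ★ **The truncation law AT the truncation level** (`h8top`), in the record sockets' binder shape: for `m < k`,
a level-`m` label `x` is a cell of the truncation at `m` iff it is one at `m + 1` or lies in dag-n05-c's CENTRED `L`-block Finset `blockSitesZ L y` of a level-`(m+1)` cell `y`
of the truncation at `m + 1` (odd `L`) — VERBATIM the `htop` binder of `B8Prop5SocketDatumRec.restr129Z_succ_of_truncation` and of the record Prop.-5 servers.
[cite: Balaban1985RegularSpaces, (1.68) p.88, (1.6) p.77, (1.131) p.99; Balaban1985Variational, (148)–(150) p.301; Balaban1987RG1, (0.3)–(0.4) pp.252–253] -/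
theorem h8top_lamST (hL : Odd L) :
    ∀ m, m < c.k → ∀ x, x ∈ c.lamST m m ↔
      x ∈ c.lamST (m + 1) m ∨ ∃ y ∈ c.lamST (m + 1) (m + 1), x ∈ blockSitesZ L y := by
  intro m hmk x
  rw [h8top_lamST_underZ c hL m hmk x]
  refine or_congr Iff.rfl (exists_congr fun y => and_congr Iff.rfl ?_)
  rw [mem_blockSitesZ_iff_underZ_one hL]

end Literature.MathematicalPhysics.QuantumFieldTheory.Balaban1983to89.B8SockHFPDentedCubeMemberRec

end
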